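import Literature.Geometry.Riemannian.NashEntropyCutoffInequality
import Literature.Geometry.Riemannian.MetricCutoff
import Literature.Geometry.Riemannian.KernelNashEntropyLipschitz
import Literature.Geometry.Riemannian.RicciFlowDistanceContinuity
import HarnessLib

/-!
# Bamler's no-local-collapsing theorem, doubling case (Bamler 2020a, Thm. 6.1)

R. Bamler, *Entropy and heat kernel bounds on a Ricci flow background*, arXiv:2008.07093 (2020a),
§6, Thm. 6.1 (arXiv v1: Thm. 22): *if `R ≤ r⁻²` on `B(x, t, r)` and `[t − r², t] ⊂ I`, then
`|B(x, t, r)|_t ≥ c exp(𝒩_{x,t}(r²)) rⁿ`.* The proof in §6.2 first reduces to the **doubling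
case** `|B(x,t,r)|_t ≤ 3ⁿ |B(x,t,r/2)|_t` and then tests the functional inequality of the pointed
Nash entropy against a cut-off of the ball. This file PROVES the doubling case at the general
scale `r = √(t − s)`, for a Ricci flow on `[a, T]` of a smooth family of Riemannian metrics on a
closed connected manifold modelled on `ℝᵐ` (`m ≥ 3`), in the form
`exists_riemVolume_ball_ge_of_doubling`: there is `c = c(m, Λ) > 0` with

  `c (t − s)^{m/2} exp(𝒩*_s(x, t)) ≤ vol_t B_t(x, √(t − s))`

whenever `a < s < t ≤ T`, `R ≥ R_min` on `M × [s, t]`, `−R_min (t − s) ≤ Λ`, `R_t ≤ 1/(t − s)` on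
`B_t(x, √(t − s))` and `vol_t B_t(x, √(t−s)) ≤ 3ᵐ vol_t B_t(x, √(t−s)/2)`.

Proof (§6.2 of the source): let `χ` be a smooth metric cut-off for `g_t` at scale
`r = √(t − s)` (`exists_metric_cutoff`: `χ = 1` on `B_{r/2}`, `tsupport χ ⊆ B_r`,
`|∇χ|² ≤ C₀/r²`), `A = ∫ χ² dg_t`, `V = vol_t M`, and for `δ > 0` the smooth positive
probability density `ψ_δ = (χ² + δ)/(A + δV)`. The functional inequality
`two_mul_integral_mul_pointedNashEntropy_le` (`NashEntropyCutoffInequality.lean`),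

  `2 ∫ ψ 𝒩*_s(·,t) ≤ (t−s) ∫ |∇ψ|²/ψ + (t−s) ∫ R ψ − 2 ∫ ψ log ψ − m log(4π(t−s)) − 3m/2 + m log 2`,

is estimated term by term: `|∇ψ_δ|²/ψ_δ ≤ 4|∇χ|²/(A + δV)`, `R χ² ≤ χ²/(t − s)`,
`−(u + v) log(u + v) ≤ −u log u − v log v`, `−y log y ≤ 1`, and on the left the Lipschitz bound
of Thm. 5.9 (`IsRicciFlow.ofReal_abs_kernelNashEntropy_sub_le`, extended to `t = T` by
continuity) gives `𝒩*_s(·, t) ≥ 𝒩*_s(x, t) − √(m/2 + Λ)` on `B_r`; finally `δ → 0` and the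
doubling hypothesis `vol B_r ≤ 3ᵐ A` yield the claim with
`c = exp(−(2·3ᵐ C₀ + 3ᵐ + 1/2 + √(m/2 + Λ)))`.

* `negMulLog_mul_add_le` — `−ψ log ψ ≤ w(−c log c) + c(−w log w) − d log d`, `ψ = cw + d`;
* `IsRicciFlow.continuousOn_kernelNashEntropy` — `(x, t) ↦ 𝒩*_s(x, t)` is continuous on
  `M × (s, T]`;
* `IsRicciFlow.abs_kernelNashEntropy_sub_le` — Thm. 5.9 in real form for `a < s < t ≤ T`;
* `IsRicciFlow.two_mul_le_of_cutoff_density` — the estimate for one density `ψ_δ`;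
* `exists_riemVolume_ball_ge_of_doubling` — **Thm. 6.1, doubling case**.

Everything is proved; no definitions, no named facts.

## References

* R. H. Bamler, *Entropy and heat kernel bounds on a Ricci flow background*, arXiv:2008.07093
  (2020), §6, Thm. 6.1 (arXiv v1 Thm. 22) and §6.2 (its proof); §5.1, Thm. 5.9.
  [Bamler2020Entropy]
* G. Perelman, *The entropy formula for the Ricci flow and its geometric applications*,
  arXiv:math/0211159 (2002), §4, Thm. 4.1. [Perelman2002]
-/

noncomputable section

open Set Filter Function MeasureTheory Measure
open scoped Manifold ContDiff Topology ENNReal NNReal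

namespace Literature.Geometry.Riemannian

open Lorentzian Lorentzian.PseudoRiemannianMetric

/-! ### An elementary entropy inequality -/

/-- **`−ψ log ψ ≤ w(−c log c) + c(−w log w) − d log d` for `ψ = c w + d`**, `c, w, d ≥ 0`: the
subadditivity `−(u+v) log(u+v) ≤ −u log u − v log v` (`log` is monotone) and the product rule
for `−y log y`. This is how the entropy of the regularised cut-off density `(χ² + δ)/Z` is
estimated in the proof of Thm. 6.1. [folklore] -/
theorem negMulLog_mul_add_le {c w d : ℝ} (hc : 0 ≤ c) (hw : 0 ≤ w) (hd : 0 ≤ d) :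
    Real.negMulLog (c * w + d) ≤
      w * Real.negMulLog c + c * Real.negMulLog w + Real.negMulLog d := by
  rw [← Real.negMulLog_mul]
  have hsub : ∀ u v : ℝ, 0 ≤ u → 0 ≤ v →
      Real.negMulLog (u + v) ≤ Real.negMulLog u + Real.negMulLog v := by
    intro u v hu hv
    rcases hu.eq_or_lt with rfl | hu'
    · simp
    rcases hv.eq_or_lt with rfl | hv'
    · simp
    have h1 := mul_le_mul_of_nonneg_left (Real.log_le_log hu' (by linarith : u ≤ u + v)) hu
    have h2 := mul_le_mul_of_nonneg_left (Real.log_le_log hv' (by linarith : v ≤ u + v)) hv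
    have e : (u + v) * Real.log (u + v) = u * Real.log (u + v) + v * Real.log (u + v) := by ring
    simp only [Real.negMulLog, neg_mul]
    linarith
  exact hsub _ _ (mul_nonneg hc hw) hd

/-! ### Continuity of `𝒩*_s(x, t)` in `(x, t)` and Thm. 5.9 up to the final time -/

section KernelEntropy

variable {m : ℕ} {M : Type*} [TopologicalSpace M] [ChartedSpace (EuclideanSpace ℝ (Fin m)) M]
  [IsManifold 𝓘(ℝ, EuclideanSpace ℝ (Fin m)) ∞ M] [T2Space M] [CompactSpace M]
  [SecondCountableTopology M] [MeasurableSpace M] [BorelSpace M] [ConnectedSpace M]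
  {h : ℝ → PseudoRiemannianMetric 𝓘(ℝ, EuclideanSpace ℝ (Fin m)) ∞ (EuclideanSpace ℝ (Fin m))
    (TangentSpace 𝓘(ℝ, EuclideanSpace ℝ (Fin m)) : M → Type _)}
  {cov : ℝ → CovariantDerivative 𝓘(ℝ, EuclideanSpace ℝ (Fin m)) (EuclideanSpace ℝ (Fin m))
    (TangentSpace 𝓘(ℝ, EuclideanSpace ℝ (Fin m)) : M → Type _)}
  {a T : ℝ} (hflow : IsRicciFlow h cov (Icc a T)) (hh : IsContMDiffFamilyOn ∞ h univ)
  (hR : ∀ r, (h r).IsRiemannian)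

/-- **`(x, t) ↦ 𝒩*_s(x, t)` is continuous on `M × (s, T]`** for `a < s < T`: by
`𝒩*_s(x,t) = ∫ −K log K dg_s − (m/2) log(4π(t − s)) − m/2` (`IsRicciFlow.kernelNashEntropy_eq`)
and the joint continuity of `((x, t), y) ↦ K(x,t;y,s)` on `(M × (s, T]) × M`
(`IsRicciFlow.continuousOn_heatKernelFn_basePoint`), `M` compact.
[cite: Bamler2020Entropy, §5.1, Def. 5.1] -/
theorem IsRicciFlow.continuousOn_kernelNashEntropy {s : ℝ} (has : a < s) (hsT : s < T) :
    ContinuousOn (fun p : M × ℝ ↦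
      pointedNashEntropy h (fun r y ↦ hflow.heatKernelFn hh hR p.2 p.1 (y, r)) m p.2 s)
      (univ ×ˢ Ioc s T) := by
  haveI : IsFiniteMeasure (h s).riemVolume := ⟨(h s).riemVolume_univ_lt_top⟩
  have hs : s ∈ Ioo a T := ⟨has, hsT⟩
  set F : M × ℝ → M → ℝ := fun p y ↦ -(hflow.heatKernelFn hh hR p.2 p.1 (y, s) *
      Real.log (hflow.heatKernelFn hh hR p.2 p.1 (y, s))) with hF
  have hK := hflow.continuousOn_heatKernelFn_basePoint hh hR hs
  have hFc : ContinuousOn (uncurry F) ((univ ×ˢ Ioc s T) ×ˢ univ) :=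
    Real.continuous_mul_log.neg.comp_continuousOn hK
  have hI : ContinuousOn (fun p : M × ℝ ↦ ∫ y, F p y ∂(h s).riemVolume) (univ ×ˢ Ioc s T) :=
    continuousOn_integral_of_compact_support isCompact_univ hFc
      (fun _ y _ hy ↦ absurd (mem_univ y) hy)
  have hlog : ContinuousOn (fun p : M × ℝ ↦ (m : ℝ) / 2 * Real.log (4 * Real.pi * (p.2 - s)))
      (univ ×ˢ Ioc s T) := by
    refine continuousOn_const.mul ((continuousOn_const.mul
      (continuousOn_snd.sub continuousOn_const)).log fun p hp ↦ ?_)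
    have : 0 < p.2 - s := sub_pos.2 hp.2.1
    exact (mul_pos (by positivity) this).ne'
  refine ((hI.sub hlog).sub (continuousOn_const (c := (m : ℝ) / 2))).congr ?_
  rintro ⟨x, t⟩ ⟨-, ht⟩
  exact hflow.kernelNashEntropy_eq hh hR ⟨has.trans ht.1, ht.2⟩ x ⟨has, ht.1⟩

/-- **Bamler 2020a, Thm. 5.9 (gradient bound), real Lipschitz form up to the final time**: for
`a < s < t ≤ T`, `R_{g_s} ≥ R_min` and all `x, x'`,
`|𝒩*_s(x, t) − 𝒩*_s(x', t)| ≤ √(m/(2(t − s)) − R_min) · d_t(x, x')`. For `t < T` this is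
`IsRicciFlow.ofReal_abs_kernelNashEntropy_sub_le`; the case `t = T` follows by letting `t' ↑ t`,
using the continuity of `𝒩*_s(x, ·)` (`continuousOn_kernelNashEntropy`) and of `t' ↦ d_{t'}(x, x')`
(`IsRicciFlow.continuousOn_edist_toReal_family`).
[cite: Bamler2020Entropy, §5.1, Thm. 5.9 (arXiv v1 Thm. 19), gradient bound] -/
theorem IsRicciFlow.abs_kernelNashEntropy_sub_le (hm : 3 ≤ m) {s t : ℝ} (has : a < s)
    (hst : s < t) (htT : t ≤ T) {Rmin : ℝ}
    (hRmin : ∀ y, Rmin ≤ (h s).scalarCurvatureWith (cov s) y) (x x' : M) :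
    |pointedNashEntropy h (fun r y ↦ hflow.heatKernelFn hh hR t x (y, r)) m t s -
        pointedNashEntropy h (fun r y ↦ hflow.heatKernelFn hh hR t x' (y, r)) m t s| ≤
      Real.sqrt ((m : ℝ) / (2 * (t - s)) - Rmin) * ((h t).edist (hR t) x x').toReal := by
  -- for `t' < T` this is Thm. 5.9
  have key : ∀ t' ∈ Ioo s t,
      |pointedNashEntropy h (fun r y ↦ hflow.heatKernelFn hh hR t' x (y, r)) m t' s -
        pointedNashEntropy h (fun r y ↦ hflow.heatKernelFn hh hR t' x' (y, r)) m t' s| ≤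
      Real.sqrt ((m : ℝ) / (2 * (t' - s)) - Rmin) * ((h t').edist (hR t') x x').toReal := by
    intro t' ht'
    have hl := hflow.ofReal_abs_kernelNashEntropy_sub_le hh hR hm has ht'.1 (ht'.2.trans_le htT)
      hRmin x x'
    have hne : (h t').edist (hR t') x x' ≠ ⊤ := PseudoRiemannianMetric.edist_ne_top (hR t') x x'
    have hL0 : 0 ≤ Real.sqrt ((m : ℝ) / (2 * (t' - s)) - Rmin) := Real.sqrt_nonneg _
    rw [← ENNReal.ofReal_toReal hne, ← ENNReal.ofReal_mul hL0,
      ENNReal.ofReal_le_ofReal_iff (by positivity)] at hl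
    exact hl
  -- both sides are continuous in `t'` at `t` from the left
  haveI : (𝓝[Ioo s t] t).NeBot := right_nhdsWithin_Ioo_neBot hst
  have hsub : Ioo s t ⊆ Ioc s T := fun u hu ↦ ⟨hu.1, hu.2.le.trans htT⟩
  have hcN : ∀ z : M, Tendsto
      (fun t' ↦ pointedNashEntropy h (fun r y ↦ hflow.heatKernelFn hh hR t' z (y, r)) m t' s)
      (𝓝[Ioo s t] t)
      (𝓝 (pointedNashEntropy h (fun r y ↦ hflow.heatKernelFn hh hR t z (y, r)) m t s)) := by
    intro z
    have hc := hflow.continuousOn_kernelNashEntropy hh hR has (hst.trans_le htT)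
    have h2 : ContinuousOn (fun t' : ℝ ↦ ((z, t') : M × ℝ)) (Ioc s T) :=
      (continuous_const.prodMk continuous_id).continuousOn
    have h1 := hc.comp h2 fun u hu ↦ ⟨mem_univ z, hu⟩
    exact ((h1 t ⟨hst, htT⟩).mono hsub).tendsto
  have hcd : Tendsto (fun t' ↦ ((h t').edist (hR t') x x').toReal) (𝓝[Ioo s t] t)
      (𝓝 ((h t).edist (hR t) x x').toReal) := by
    have haT : a ≤ T := (has.trans (hst.trans_le htT)).le
    have hc := hflow.continuousOn_edist_toReal_family haT hR
    have h2 : ContinuousOn (fun t' : ℝ ↦ ((x, x', t') : M × M × ℝ)) (Icc a T) :=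
      (continuous_const.prodMk (continuous_const.prodMk continuous_id)).continuousOn
    have h1 := hc.comp h2 fun u hu ↦ ⟨mem_univ x, mem_univ x', hu⟩
    exact ((h1 t ⟨(has.trans hst).le, htT⟩).mono
      fun u hu ↦ ⟨(has.trans hu.1).le, hu.2.le.trans htT⟩).tendsto
  have hcL : Tendsto (fun t' ↦ Real.sqrt ((m : ℝ) / (2 * (t' - s)) - Rmin)) (𝓝[Ioo s t] t)
      (𝓝 (Real.sqrt ((m : ℝ) / (2 * (t - s)) - Rmin))) := by
    refine (ContinuousAt.tendsto ?_).mono_left nhdsWithin_le_nhds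
    have hne : 2 * (t - s) ≠ 0 := by have := sub_pos.2 hst; positivity
    exact ((continuousAt_const.div (continuousAt_const.mul
      (continuousAt_id.sub continuousAt_const)) hne).sub continuousAt_const).sqrt
  refine le_of_tendsto_of_tendsto (((hcN x).sub (hcN x')).abs) (hcL.mul hcd) ?_
  filter_upwards [self_mem_nhdsWithin] with t' ht' using key t' ht'

/-! ### The estimate for one regularised cut-off density -/

/-- **The core estimate of the proof of Thm. 6.1 for one regularised cut-off density** (Bamler
2020a, §6.2). Let `a < s < t ≤ T`, `R_{g_s} ≥ R_min`, `r² = t − s`, `R_t ≤ 1/(t − s)` on the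
ball `B = B_t(x, r)`, and let `χ : M → [0, 1]` be smooth with `tsupport χ ⊆ B` and
`|∇χ|²_{g_t} ≤ C₀/r²`; put `A = ∫ χ² dg_t > 0`, `V = vol_t M`, and for `δ > 0` let
`ψ = (χ² + δ)/(A + δV)` (smooth, positive, unit mass). Then the functional inequality
`two_mul_integral_mul_pointedNashEntropy_le` for `ψ`, together with
`∫ χ² 𝒩*_s(·,t) ≥ (𝒩*_s(x,t) − √(m/(2(t−s)) − R_min)·r) A` (Thm. 5.9 on `B`),
`|∇ψ|²/ψ ≤ 4|∇χ|²/(A + δV)`, `R χ² ≤ χ²/(t − s)`, `−ψ log ψ ≤ −u log u − v log v`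
(`u = χ²/(A+δV)`, `v = δ/(A+δV)`) and `−χ² log χ² ≤ 𝟙_B`, gives the displayed inequality, whose
`δ → 0` limit is `2𝒩*_s(x,t) ≤ 4C₀ vol B/A + 1 + 2 log A + 2 vol B/A − m log(4π(t−s)) − 3m/2
+ m log 2 + 2√(m/(2(t−s)) − R_min)·r`. [cite: Bamler2020Entropy, §6.2, proof of Thm. 6.1] -/
theorem IsRicciFlow.two_mul_le_of_cutoff_density (hm : 3 ≤ m) {s t : ℝ} (has : a < s)
    (hst : s < t) (htT : t ≤ T) {Rmin : ℝ}
    (hRmin : ∀ y, Rmin ≤ (h s).scalarCurvatureWith (cov s) y) {x : M} {r : ℝ} (hr0 : 0 < r)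
    (hr2 : r ^ 2 = t - s)
    (hRup : ∀ y ∈ (h t).ball x (ENNReal.ofReal r),
      (h t).scalarCurvatureWith (cov t) y ≤ 1 / (t - s))
    {χ : M → ℝ} {C₀ : ℝ} (hχs : ContMDiff 𝓘(ℝ, EuclideanSpace ℝ (Fin m)) 𝓘(ℝ, ℝ) ∞ χ)
    (hχ0 : ∀ y, 0 ≤ χ y) (hχ1 : ∀ y, χ y ≤ 1)
    (hχsupp : tsupport χ ⊆ (h t).ball x (ENNReal.ofReal r))
    (hχK : ∀ y, (h t).gradSq χ y ≤ C₀ / r ^ 2) {A B V δ : ℝ}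
    (hA : ∫ y, χ y ^ 2 ∂(h t).riemVolume = A) (hApos : 0 < A)
    (hB : (h t).riemVolume.real ((h t).ball x (ENNReal.ofReal r)) = B)
    (hV : (h t).riemVolume.real univ = V) (hδ : 0 < δ) :
    2 * ((A + δ * V)⁻¹ *
        ((pointedNashEntropy h (fun r' w ↦ hflow.heatKernelFn hh hR t x (w, r')) m t s -
            Real.sqrt ((m : ℝ) / (2 * (t - s)) - Rmin) * r) * A) +
          (A + δ * V)⁻¹ * δ *
            ∫ y, pointedNashEntropy h (fun r' w ↦ hflow.heatKernelFn hh hR t y (w, r')) m t s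
              ∂(h t).riemVolume) ≤
      4 * C₀ * B / (A + δ * V) +
        (A / (A + δ * V) + (t - s) * δ *
          (∫ y, (h t).scalarCurvatureWith (cov t) y ∂(h t).riemVolume) / (A + δ * V)) +
        2 * (A / (A + δ * V) * Real.log (A + δ * V) + B / (A + δ * V) +
          V * Real.negMulLog (δ / (A + δ * V))) -
        (m : ℝ) * Real.log (4 * Real.pi * (t - s)) - 3 * (m : ℝ) / 2 + (m : ℝ) * Real.log 2 := by
  have hτ : 0 < t - s := sub_pos.2 hst
  have ht : t ∈ Icc a T := ⟨(has.trans hst).le, htT⟩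
  haveI : IsFiniteMeasure (h t).riemVolume := ⟨(h t).riemVolume_univ_lt_top⟩
  have hV0 : 0 ≤ V := by rw [← hV]; exact measureReal_nonneg
  set B₁ : Set M := (h t).ball x (ENNReal.ofReal r) with hB₁
  -- facts about `χ`
  have hχc : Continuous χ := hχs.continuous
  have hχd : ∀ y, MDifferentiableAt 𝓘(ℝ, EuclideanSpace ℝ (Fin m)) 𝓘(ℝ, ℝ) χ y := fun y ↦
    (hχs y).mdifferentiableAt (by simp)
  have hχ_out : ∀ y, y ∉ B₁ → χ y = 0 := fun y hy ↦
    image_eq_zero_of_notMem_tsupport fun h' ↦ hy (hχsupp h')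
  have hχ_in : ∀ y, χ y ≠ 0 → y ∈ B₁ := fun y hy ↦ by
    by_contra h'
    exact hy (hχ_out y h')
  have hχsq_le : ∀ y, χ y ^ 2 ≤ 1 := fun y ↦ by
    have := hχ1 y; have := hχ0 y; nlinarith
  have hgrad_out : ∀ y, y ∉ B₁ → (h t).gradSq χ y = 0 := fun y hy ↦
    (h t).gradSq_eq_zero_of_mvfderiv_eq_zero
      (mvfderiv_eq_zero_of_notMem_tsupport fun h' ↦ hy (hχsupp h'))
  have hgrad_nn : ∀ y, 0 ≤ (h t).gradSq χ y := (h t).gradSq_nonneg (hR t) χ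
  have hgradc : Continuous ((h t).gradSq χ) :=
    continuous_innerDual_mvfderiv (h t) (hχs.of_le (by norm_num)) (hχs.of_le (by norm_num))
  have hχ2c : Continuous fun y ↦ χ y ^ 2 := hχc.pow 2
  have hχ2i : Integrable (fun y ↦ χ y ^ 2) (h t).riemVolume := (h t).integrable_of_continuous hχ2c
  -- the pointed Nash entropy at time `t` as a function of the base point
  obtain ⟨N, hN⟩ : ∃ N : M → ℝ, ∀ y,
      N y = pointedNashEntropy h (fun r' w ↦ hflow.heatKernelFn hh hR t y (w, r')) m t s :=
    ⟨_, fun _ ↦ rfl⟩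
  simp only [← hN]
  have hNc : Continuous N := by
    rw [show N = _ from funext hN]
    have hc := hflow.continuousOn_kernelNashEntropy hh hR has (hst.trans_le htT)
    have h1 := hc.comp_continuous (continuous_id.prodMk continuous_const)
      fun y ↦ (⟨mem_univ y, ⟨hst, htT⟩⟩ : (y, t) ∈ univ ×ˢ Ioc s T)
    exact h1
  obtain ⟨D, hD⟩ : ∃ D : ℝ, Real.sqrt ((m : ℝ) / (2 * (t - s)) - Rmin) * r = D := ⟨_, rfl⟩
  rw [hD]
  have hNlow : ∀ y ∈ B₁, N x - D ≤ N y := by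
    intro y hy
    have hy' : (h t).edist (hR t) x y < ENNReal.ofReal r := by
      simpa [hB₁, PseudoRiemannianMetric.mem_ball, PseudoRiemannianMetric.riemEDist_eq (hR t)]
        using hy
    have hd : ((h t).edist (hR t) x y).toReal < r := ENNReal.toReal_lt_of_lt_ofReal hy'
    have hl := hflow.abs_kernelNashEntropy_sub_le hh hR hm has hst htT hRmin x y
    rw [← hN x, ← hN y] at hl
    have hL0 : 0 ≤ Real.sqrt ((m : ℝ) / (2 * (t - s)) - Rmin) := Real.sqrt_nonneg _
    have h1 := (abs_sub_le_iff.1 hl).1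
    have h2 := mul_le_mul_of_nonneg_left hd.le hL0
    rw [hD] at h2
    linarith only [h1, h2]
  -- the scalar curvature at time `t`
  have hRc : Continuous fun y ↦ (h t).scalarCurvatureWith (cov t) y :=
    (contMDiff_scalarCurvatureWith_holds 𝓘(ℝ, EuclideanSpace ℝ (Fin m)) M (h t) (cov t)
      (hflow.isLeviCivita t ht)).continuous
  obtain ⟨IR, hIR⟩ : ∃ IR : ℝ, ∫ y, (h t).scalarCurvatureWith (cov t) y ∂(h t).riemVolume = IR :=
    ⟨_, rfl⟩
  obtain ⟨IN, hIN⟩ : ∃ IN : ℝ, ∫ y, N y ∂(h t).riemVolume = IN := ⟨_, rfl⟩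
  rw [hIR, hIN]
  set Z : ℝ := A + δ * V with hZ
  have hZpos : 0 < Z := by positivity
  -- the density `ψ = (χ² + δ)/Z`: smooth, positive, unit mass
  set ψ : M → ℝ := fun y ↦ Z⁻¹ * (χ y ^ 2 + δ) with hψ
  have hF : ContDiff ℝ ∞ (fun u : ℝ ↦ Z⁻¹ * (u ^ 2 + δ)) := by fun_prop
  have hψs : ContMDiff 𝓘(ℝ, EuclideanSpace ℝ (Fin m)) 𝓘(ℝ, ℝ) ∞ ψ := by
    have := hF.comp_contMDiff hχs
    exact this
  have hψpos : ∀ y, 0 < ψ y := fun y ↦ by positivity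
  have hψc : Continuous ψ := hψs.continuous
  have hψ1 : ∫ y, ψ y ∂(h t).riemVolume = 1 := by
    simp only [hψ]
    rw [integral_const_mul, integral_add hχ2i (integrable_const δ), integral_const, smul_eq_mul,
      hA, hV, hZ]
    field_simp
  -- the functional inequality
  have main := two_mul_integral_mul_pointedNashEntropy_le hflow hh hR has hst htT hψs hψpos hψ1
  simp only [← hN] at main
  -- (L) the left-hand side
  have hiχN : Integrable (fun y ↦ χ y ^ 2 * N y) (h t).riemVolume :=
    (h t).integrable_of_continuous (hχ2c.mul hNc)
  have hiN : Integrable N (h t).riemVolume := (h t).integrable_of_continuous hNc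
  have hLHS : Z⁻¹ * ((N x - D) * A) + Z⁻¹ * δ * IN ≤ ∫ y, ψ y * N y ∂(h t).riemVolume := by
    have e : ∫ y, ψ y * N y ∂(h t).riemVolume =
        Z⁻¹ * ∫ y, χ y ^ 2 * N y ∂(h t).riemVolume + Z⁻¹ * δ * IN := by
      have e1 : ∀ y, ψ y * N y = Z⁻¹ * (χ y ^ 2 * N y) + Z⁻¹ * δ * N y := fun y ↦ by
        simp only [hψ]; ring
      simp_rw [e1]
      rw [integral_add (hiχN.const_mul _) (hiN.const_mul _), integral_const_mul,
        integral_const_mul, hIN]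
    have h1 : (N x - D) * A ≤ ∫ y, χ y ^ 2 * N y ∂(h t).riemVolume := by
      rw [← hA, ← integral_const_mul]
      refine integral_mono (hχ2i.const_mul _) hiχN fun y ↦ ?_
      by_cases hy : χ y = 0
      · simp [hy]
      · have := hNlow y (hχ_in y hy)
        show (N x - D) * χ y ^ 2 ≤ χ y ^ 2 * N y
        nlinarith [sq_nonneg (χ y)]
    rw [e]
    have := mul_le_mul_of_nonneg_left h1 (inv_pos.2 hZpos).le
    linarith only [this]
  -- (G) the gradient term
  have hgradψ : ∀ y, (h t).gradSq ψ y = (Z⁻¹ * (2 * χ y)) ^ 2 * (h t).gradSq χ y := by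
    intro y
    have hFd : HasDerivAt (fun u : ℝ ↦ Z⁻¹ * (u ^ 2 + δ)) (Z⁻¹ * (2 * χ y)) (χ y) := by
      simpa using ((hasDerivAt_pow 2 (χ y)).add_const δ).const_mul Z⁻¹
    rw [show ψ = (fun u : ℝ ↦ Z⁻¹ * (u ^ 2 + δ)) ∘ χ from rfl, (h t).gradSq_real_comp hFd (hχd y)]
  have hGpt : ∀ y, (h t).gradSq ψ y / ψ y ≤ 4 / Z * (h t).gradSq χ y := by
    intro y
    rw [hgradψ y]
    simp only [hψ]
    have hq : 0 < χ y ^ 2 + δ := by positivity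
    have e : (Z⁻¹ * (2 * χ y)) ^ 2 * (h t).gradSq χ y / (Z⁻¹ * (χ y ^ 2 + δ)) =
        4 / Z * (h t).gradSq χ y * (χ y ^ 2 / (χ y ^ 2 + δ)) := by
      field_simp
      ring
    rw [e]
    refine mul_le_of_le_one_right (mul_nonneg (by positivity) (hgrad_nn y)) ?_
    exact div_le_one_of_le₀ (by linarith) hq.le
  have hgradψc : Continuous ((h t).gradSq ψ) :=
    continuous_innerDual_mvfderiv (h t) (hψs.of_le (by norm_num)) (hψs.of_le (by norm_num))
  have hG : (t - s) * ∫ y, (h t).gradSq ψ y / ψ y ∂(h t).riemVolume ≤ 4 * C₀ * B / Z := by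
    have h1 : ∫ y, (h t).gradSq ψ y / ψ y ∂(h t).riemVolume ≤
        ∫ y, 4 / Z * (h t).gradSq χ y ∂(h t).riemVolume :=
      integral_mono ((h t).integrable_of_continuous (hgradψc.div hψc fun y ↦ (hψpos y).ne'))
        ((h t).integrable_of_continuous (continuous_const.mul hgradc)) hGpt
    have h2 : ∫ y, (h t).gradSq χ y ∂(h t).riemVolume ≤ C₀ / r ^ 2 * B := by
      rw [← setIntegral_eq_integral_of_forall_compl_eq_zero hgrad_out]
      have := norm_setIntegral_le_of_norm_le_const (measure_lt_top (h t).riemVolume B₁)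
        (f := (h t).gradSq χ) (C := C₀ / r ^ 2)
        (fun y _ ↦ by rw [Real.norm_eq_abs, abs_of_nonneg (hgrad_nn y)]; exact hχK y)
      rw [hB] at this
      exact (Real.le_norm_self _).trans this
    rw [integral_const_mul] at h1
    have h3 : (t - s) * ∫ y, (h t).gradSq ψ y / ψ y ∂(h t).riemVolume ≤
        (t - s) * (4 / Z * (C₀ / r ^ 2 * B)) :=
      mul_le_mul_of_nonneg_left (h1.trans (mul_le_mul_of_nonneg_left h2 (by positivity))) hτ.le
    refine h3.trans (le_of_eq ?_)
    rw [← hr2]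
    field_simp
  -- (R) the scalar curvature term
  have hRψ : (t - s) * ∫ y, (h t).scalarCurvatureWith (cov t) y * ψ y ∂(h t).riemVolume ≤
      A / Z + (t - s) * δ * IR / Z := by
    have hiRχ : Integrable (fun y ↦ (h t).scalarCurvatureWith (cov t) y * χ y ^ 2)
        (h t).riemVolume := (h t).integrable_of_continuous (hRc.mul hχ2c)
    have hiR : Integrable (fun y ↦ (h t).scalarCurvatureWith (cov t) y) (h t).riemVolume :=
      (h t).integrable_of_continuous hRc
    have e : ∫ y, (h t).scalarCurvatureWith (cov t) y * ψ y ∂(h t).riemVolume =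
        Z⁻¹ * ∫ y, (h t).scalarCurvatureWith (cov t) y * χ y ^ 2 ∂(h t).riemVolume +
          Z⁻¹ * δ * IR := by
      have e1 : ∀ y, (h t).scalarCurvatureWith (cov t) y * ψ y =
          Z⁻¹ * ((h t).scalarCurvatureWith (cov t) y * χ y ^ 2) +
            Z⁻¹ * δ * (h t).scalarCurvatureWith (cov t) y := fun y ↦ by
        simp only [hψ]; ring
      simp_rw [e1]
      rw [integral_add (hiRχ.const_mul _) (hiR.const_mul _), integral_const_mul,
        integral_const_mul, hIR]
    have h1 : ∫ y, (h t).scalarCurvatureWith (cov t) y * χ y ^ 2 ∂(h t).riemVolume ≤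
        (t - s)⁻¹ * A := by
      rw [← hA, ← integral_const_mul]
      refine integral_mono hiRχ (hχ2i.const_mul _) fun y ↦ ?_
      by_cases hy : χ y = 0
      · simp [hy]
      · have := hRup y (hχ_in y hy)
        rw [one_div] at this
        exact mul_le_mul_of_nonneg_right this (sq_nonneg _)
    have h2 : (t - s) * (Z⁻¹ * ∫ y, (h t).scalarCurvatureWith (cov t) y * χ y ^ 2
        ∂(h t).riemVolume) ≤ A / Z := by
      calc (t - s) * (Z⁻¹ * ∫ y, (h t).scalarCurvatureWith (cov t) y * χ y ^ 2
            ∂(h t).riemVolume) ≤ (t - s) * (Z⁻¹ * ((t - s)⁻¹ * A)) :=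
            mul_le_mul_of_nonneg_left (mul_le_mul_of_nonneg_left h1 (inv_pos.2 hZpos).le)
              hτ.le
        _ = A / Z := by
            rw [mul_left_comm, mul_inv_cancel_left₀ hτ.ne', div_eq_mul_inv, mul_comm]
    have h3 : (t - s) * (Z⁻¹ * δ * IR) = (t - s) * δ * IR / Z := by
      rw [div_eq_mul_inv]
      ring
    rw [e, mul_add, h3]
    exact add_le_add h2 le_rfl
  -- (E) the entropy term
  have hE : -(∫ y, ψ y * Real.log (ψ y) ∂(h t).riemVolume) ≤
      A / Z * Real.log Z + B / Z + V * Real.negMulLog (δ / Z) := by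
    have e1 : -(∫ y, ψ y * Real.log (ψ y) ∂(h t).riemVolume) =
        ∫ y, Real.negMulLog (ψ y) ∂(h t).riemVolume := by
      rw [← integral_neg]
      simp only [Real.negMulLog, neg_mul]
    have hpt : ∀ y, Real.negMulLog (ψ y) ≤ χ y ^ 2 * Real.negMulLog Z⁻¹ +
        Z⁻¹ * Real.negMulLog (χ y ^ 2) + Real.negMulLog (Z⁻¹ * δ) := by
      intro y
      simp only [hψ]
      rw [mul_add]
      exact negMulLog_mul_add_le (inv_pos.2 hZpos).le (sq_nonneg _) (by positivity)
    have hnc : Continuous fun y ↦ Real.negMulLog (χ y ^ 2) := Real.continuous_negMulLog.comp hχ2c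
    have hi1 : Integrable (fun y ↦ χ y ^ 2 * Real.negMulLog Z⁻¹) (h t).riemVolume :=
      hχ2i.mul_const _
    have hi2 : Integrable (fun y ↦ Z⁻¹ * Real.negMulLog (χ y ^ 2)) (h t).riemVolume :=
      ((h t).integrable_of_continuous hnc).const_mul _
    have h1 : ∫ y, Real.negMulLog (ψ y) ∂(h t).riemVolume ≤
        ∫ y, (χ y ^ 2 * Real.negMulLog Z⁻¹ + Z⁻¹ * Real.negMulLog (χ y ^ 2) +
          Real.negMulLog (Z⁻¹ * δ)) ∂(h t).riemVolume :=
      integral_mono ((h t).integrable_of_continuous (Real.continuous_negMulLog.comp hψc))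
        ((hi1.add hi2).add (integrable_const _)) hpt
    have h2 : ∫ y, (χ y ^ 2 * Real.negMulLog Z⁻¹ + Z⁻¹ * Real.negMulLog (χ y ^ 2) +
          Real.negMulLog (Z⁻¹ * δ)) ∂(h t).riemVolume =
        A * Real.negMulLog Z⁻¹ + Z⁻¹ * ∫ y, Real.negMulLog (χ y ^ 2) ∂(h t).riemVolume +
          V * Real.negMulLog (Z⁻¹ * δ) := by
      rw [integral_add (f := fun y ↦ χ y ^ 2 * Real.negMulLog Z⁻¹ +
          Z⁻¹ * Real.negMulLog (χ y ^ 2)) (g := fun _ ↦ Real.negMulLog (Z⁻¹ * δ))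
          (hi1.add hi2) (integrable_const _),
        integral_add hi1 hi2, integral_mul_const, integral_const_mul, integral_const, smul_eq_mul,
        hA, hV]
    have h3 : ∫ y, Real.negMulLog (χ y ^ 2) ∂(h t).riemVolume ≤ B := by
      have h0 : ∀ y, y ∉ B₁ → Real.negMulLog (χ y ^ 2) = 0 := fun y hy ↦ by
        simp [hχ_out y hy]
      rw [← setIntegral_eq_integral_of_forall_compl_eq_zero h0]
      have := norm_setIntegral_le_of_norm_le_const (measure_lt_top (h t).riemVolume B₁)
        (f := fun y ↦ Real.negMulLog (χ y ^ 2)) (C := 1)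
        (fun y _ ↦ by
          rw [Real.norm_eq_abs, abs_of_nonneg (Real.negMulLog_nonneg (sq_nonneg _)
            (hχsq_le y))]
          exact (Real.negMulLog_le_one_sub_self (sq_nonneg _)).trans
            (by linarith only [sq_nonneg (χ y)]))
      rw [one_mul, hB] at this
      exact (Real.le_norm_self _).trans this
    have h4 : Real.negMulLog Z⁻¹ = Z⁻¹ * Real.log Z := by
      rw [Real.negMulLog, Real.log_inv]
      ring
    have h5 : Z⁻¹ * ∫ y, Real.negMulLog (χ y ^ 2) ∂(h t).riemVolume ≤ B / Z := by
      rw [div_eq_inv_mul]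
      exact mul_le_mul_of_nonneg_left h3 (inv_pos.2 hZpos).le
    rw [e1]
    refine (h1.trans_eq h2).trans ?_
    rw [h4, inv_mul_eq_div Z δ]
    have e6 : A * (Z⁻¹ * Real.log Z) = A / Z * Real.log Z := by ring
    rw [e6]
    linarith only [h5]
  -- combine
  linarith only [main, hLHS, hG, hRψ, hE]

end KernelEntropy

/-! ### Thm. 6.1, doubling case -/

/-- **Bamler 2020a, Thm. 6.1 (no local collapsing), doubling case, general scale.** For every
`m ≥ 3` and `Λ ≥ 0` there is `c = c(m, Λ) > 0` such that for every Ricci flow `hflow` on `[a, T]`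
of a smooth family of Riemannian metrics on a closed connected manifold modelled on `ℝᵐ`, all
`a < s < t ≤ T` with `R ≥ R_min` on `M × [s, t]` and `−R_min (t − s) ≤ Λ`, and every `x` with
`R_t ≤ 1/(t − s)` on `B = B_t(x, √(t − s))` and `vol_t B ≤ 3ᵐ vol_t B_t(x, √(t − s)/2)`:

  `c (t − s)^{m/2} exp(𝒩*_s(x, t)) ≤ vol_t B`,

where `𝒩*_s(x, t) = 𝒩_{x,t}(t − s)` is the pointed Nash entropy of the conjugate heat kernel based
at `(x, t)` at time `s` ("`|B(x, t, r)|_t ≥ c exp(𝒩_{x,t}(r²)) rⁿ`", the case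
`|B(x,0,r)|_0 ≤ 3ⁿ|B(x,0,r/2)|_0` of the printed proof, `r² = t − s`). Proof: test
`two_mul_integral_mul_pointedNashEntropy_le` with `ψ_δ = (χ² + δ)/(∫χ² + δ vol M)` for a metric
cut-off `χ` of the ball (`exists_metric_cutoff`, `IsRicciFlow.two_mul_le_of_cutoff_density`) and
let `δ → 0`; see the module docstring. The constant is
`c = exp(−(2·3ᵐ C₀ + 3ᵐ + 1/2 + √(m/2 + Λ)))` with `C₀` the universal cut-off constant.
[cite: Bamler2020Entropy, §6, Thm. 6.1 (arXiv v1 Thm. 22), proof in §6.2] -/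
theorem exists_riemVolume_ball_ge_of_doubling (m : ℕ) (hm : 3 ≤ m) {Λ : ℝ} (hΛ : 0 ≤ Λ) :
    ∃ c : ℝ, 0 < c ∧ ∀ {M : Type*} [TopologicalSpace M]
      [ChartedSpace (EuclideanSpace ℝ (Fin m)) M]
      [IsManifold 𝓘(ℝ, EuclideanSpace ℝ (Fin m)) ∞ M] [T2Space M] [CompactSpace M]
      [SecondCountableTopology M] [MeasurableSpace M] [BorelSpace M] [ConnectedSpace M] [T3Space M]
      {h : ℝ → PseudoRiemannianMetric 𝓘(ℝ, EuclideanSpace ℝ (Fin m)) ∞ (EuclideanSpace ℝ (Fin m))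
        (TangentSpace 𝓘(ℝ, EuclideanSpace ℝ (Fin m)) : M → Type _)}
      {cov : ℝ → CovariantDerivative 𝓘(ℝ, EuclideanSpace ℝ (Fin m)) (EuclideanSpace ℝ (Fin m))
        (TangentSpace 𝓘(ℝ, EuclideanSpace ℝ (Fin m)) : M → Type _)}
      {a T : ℝ} (hflow : IsRicciFlow h cov (Icc a T)) (hh : IsContMDiffFamilyOn ∞ h univ)
      (hR : ∀ r, (h r).IsRiemannian),
      ∀ {s t : ℝ}, a < s → s < t → t ≤ T → ∀ {Rmin : ℝ},
      (∀ r ∈ Icc s t, ∀ z : M, Rmin ≤ (h r).scalarCurvatureWith (cov r) z) →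
      -Rmin * (t - s) ≤ Λ → ∀ x : M,
      (∀ y : M, (h t).edist (hR t) x y < ENNReal.ofReal (Real.sqrt (t - s)) →
        (h t).scalarCurvatureWith (cov t) y ≤ 1 / (t - s)) →
      (h t).riemVolume.real {y | (h t).edist (hR t) x y < ENNReal.ofReal (Real.sqrt (t - s))} ≤
        3 ^ m * (h t).riemVolume.real
          {y | (h t).edist (hR t) x y < ENNReal.ofReal (Real.sqrt (t - s) / 2)} →
      c * (t - s) ^ ((m : ℝ) / 2) *
          Real.exp (pointedNashEntropy h (fun r v ↦ hflow.heatKernelFn hh hR t x (v, r)) m t s) ≤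
        (h t).riemVolume.real
          {y | (h t).edist (hR t) x y < ENNReal.ofReal (Real.sqrt (t - s))} := by
  have _ := hΛ -- the sign of `Λ` plays no role in the estimate
  obtain ⟨C₀, hC₀⟩ := exists_metric_cutoff
  refine ⟨Real.exp (-(2 * 3 ^ m * C₀ + 3 ^ m + 1 / 2 + Real.sqrt ((m : ℝ) / 2 + Λ))),
    Real.exp_pos _, ?_⟩
  intro M _ _ _ _ _ _ _ _ _ _ h cov a T hflow hh hR s t has hst htT Rmin hRmin hRΛ x hRup hdoub
  /- ─── basic quantities ─── -/
  have hτ : 0 < t - s := sub_pos.2 hst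
  set r : ℝ := Real.sqrt (t - s) with hr
  have hr0 : 0 < r := Real.sqrt_pos.2 hτ
  have hr2 : r ^ 2 = t - s := Real.sq_sqrt hτ.le
  haveI : IsFiniteMeasure (h t).riemVolume := ⟨(h t).riemVolume_univ_lt_top⟩
  have hball : ∀ ρ : ℝ, {y | (h t).edist (hR t) x y < ENNReal.ofReal ρ} =
      (h t).ball x (ENNReal.ofReal ρ) := fun ρ ↦ by
    ext y
    simp [PseudoRiemannianMetric.mem_ball, PseudoRiemannianMetric.riemEDist_eq (hR t)]
  simp only [hball] at hdoub ⊢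
  have hRup' : ∀ y ∈ (h t).ball x (ENNReal.ofReal r),
      (h t).scalarCurvatureWith (cov t) y ≤ 1 / (t - s) := fun y hy ↦
    hRup y (by simpa [PseudoRiemannianMetric.mem_ball,
      PseudoRiemannianMetric.riemEDist_eq (hR t)] using hy)
  set B₁ : Set M := (h t).ball x (ENNReal.ofReal r) with hB₁
  set B₂ : Set M := (h t).ball x (ENNReal.ofReal (r / 2)) with hB₂
  have hB₂m : MeasurableSet B₂ := (PseudoRiemannianMetric.isOpen_ball (hR t) x _).measurableSet
  have hfin : ∀ S : Set M, (h t).riemVolume S ≠ ⊤ := fun S ↦ measure_ne_top _ S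
  -- volumes
  obtain ⟨B, hB⟩ : ∃ B : ℝ, (h t).riemVolume.real B₁ = B := ⟨_, rfl⟩
  obtain ⟨B', hB'⟩ : ∃ B' : ℝ, (h t).riemVolume.real B₂ = B' := ⟨_, rfl⟩
  obtain ⟨V, hV⟩ : ∃ V : ℝ, (h t).riemVolume.real univ = V := ⟨_, rfl⟩
  rw [hB, hB'] at hdoub
  rw [hB]
  have hB'pos : 0 < B' := by
    rw [← hB', measureReal_def]
    exact ENNReal.toReal_pos (PseudoRiemannianMetric.vol_ball_pos (hR t) x
      (ENNReal.ofReal_pos.2 (half_pos hr0))).ne' (hfin _)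
  have hV0 : 0 ≤ V := by rw [← hV]; exact measureReal_nonneg
  /- ─── the cut-off ─── -/
  obtain ⟨χ, hχs, hχ0, hχ1, hχB, hχsupp, hχK⟩ :=
    hC₀ 𝓘(ℝ, EuclideanSpace ℝ (Fin m)) M (h t) (hR t) x r hr0
  have hχc : Continuous χ := hχs.continuous
  have hχ_out : ∀ y, y ∉ B₁ → χ y = 0 := fun y hy ↦
    image_eq_zero_of_notMem_tsupport fun h' ↦ hy (hχsupp h')
  have hχsq_le : ∀ y, χ y ^ 2 ≤ 1 := fun y ↦ by
    have := hχ1 y; have := hχ0 y; nlinarith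
  have hC₀0 : 0 ≤ C₀ := by
    have h1 : 0 ≤ C₀ / r ^ 2 := ((h t).gradSq_nonneg (hR t) χ x).trans (hχK x)
    have h2 : 0 < r ^ 2 := by positivity
    have := (le_div_iff₀ h2).1 h1
    linarith only [this]
  have hχ2i : Integrable (fun y ↦ χ y ^ 2) (h t).riemVolume :=
    (h t).integrable_of_continuous (hχc.pow 2)
  -- `A = ∫ χ²`, `B' ≤ A ≤ B ≤ 3ᵐ B' ≤ 3ᵐ A`
  obtain ⟨A, hA⟩ : ∃ A : ℝ, ∫ y, χ y ^ 2 ∂(h t).riemVolume = A := ⟨_, rfl⟩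
  have hB'A : B' ≤ A := by
    have h1 : ∫ y in B₂, (1 : ℝ) ∂(h t).riemVolume ≤ ∫ y in B₂, χ y ^ 2 ∂(h t).riemVolume :=
      setIntegral_mono_on (integrableOn_const (hfin _)) hχ2i.integrableOn hB₂m
        (fun y hy ↦ by rw [hχB y hy]; norm_num)
    have h2 : ∫ y in B₂, χ y ^ 2 ∂(h t).riemVolume ≤ A :=
      hA ▸ setIntegral_le_integral hχ2i (Eventually.of_forall fun y ↦ sq_nonneg _)
    have h3 : ∫ y in B₂, (1 : ℝ) ∂(h t).riemVolume = B' := by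
      rw [setIntegral_const, smul_eq_mul, mul_one, hB']
    linarith only [h1, h2, h3]
  have hApos : 0 < A := hB'pos.trans_le hB'A
  have hAB : A ≤ B := by
    have h0 : ∀ y, y ∉ B₁ → χ y ^ 2 = 0 := fun y hy ↦ by simp [hχ_out y hy]
    rw [← hA, ← setIntegral_eq_integral_of_forall_compl_eq_zero h0]
    have h1 := norm_setIntegral_le_of_norm_le_const (measure_lt_top (h t).riemVolume B₁)
      (f := fun y ↦ χ y ^ 2) (C := 1)
      (fun y _ ↦ by rw [Real.norm_eq_abs, abs_of_nonneg (sq_nonneg _)]; exact hχsq_le y)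
    rw [one_mul, hB] at h1
    exact (Real.le_norm_self _).trans h1
  have hBpos : 0 < B := hApos.trans_le hAB
  have hBA : B ≤ 3 ^ m * A := hdoub.trans (by gcongr)
  /- ─── the estimate for `ψ_δ`, `δ > 0`, and its limit `δ → 0⁺` ─── -/
  obtain ⟨N, hN⟩ : ∃ N : M → ℝ, ∀ y,
      N y = pointedNashEntropy h (fun r' w ↦ hflow.heatKernelFn hh hR t y (w, r')) m t s :=
    ⟨_, fun _ ↦ rfl⟩
  rw [← hN x]
  obtain ⟨D, hD⟩ : ∃ D : ℝ, Real.sqrt ((m : ℝ) / (2 * (t - s)) - Rmin) * r = D := ⟨_, rfl⟩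
  obtain ⟨IR, hIR⟩ : ∃ IR : ℝ, ∫ y, (h t).scalarCurvatureWith (cov t) y ∂(h t).riemVolume = IR :=
    ⟨_, rfl⟩
  obtain ⟨IN, hIN⟩ : ∃ IN : ℝ, ∫ y, N y ∂(h t).riemVolume = IN := ⟨_, rfl⟩
  have hRmin' : ∀ y, Rmin ≤ (h s).scalarCurvatureWith (cov s) y := fun y ↦
    hRmin s ⟨le_rfl, hst.le⟩ y
  obtain ⟨L, hL⟩ : ∃ L : ℝ → ℝ, ∀ δ, L δ =
      2 * ((A + δ * V)⁻¹ * ((N x - D) * A) + (A + δ * V)⁻¹ * δ * IN) := ⟨_, fun _ ↦ rfl⟩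
  obtain ⟨U, hU⟩ : ∃ U : ℝ → ℝ, ∀ δ, U δ =
      4 * C₀ * B / (A + δ * V) + (A / (A + δ * V) + (t - s) * δ * IR / (A + δ * V)) +
        2 * (A / (A + δ * V) * Real.log (A + δ * V) + B / (A + δ * V) +
          V * Real.negMulLog (δ / (A + δ * V))) -
        (m : ℝ) * Real.log (4 * Real.pi * (t - s)) - 3 * (m : ℝ) / 2 + (m : ℝ) * Real.log 2 :=
    ⟨_, fun _ ↦ rfl⟩
  have key : ∀ δ : ℝ, 0 < δ → L δ ≤ U δ := by
    intro δ hδ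
    have k := hflow.two_mul_le_of_cutoff_density hh hR hm has hst htT hRmin' hr0 hr2 hRup' hχs
      hχ0 hχ1 hχsupp hχK hA hApos hB hV hδ
    simp only [← hN] at k
    rw [hD, hIR, hIN] at k
    rw [hL, hU]
    exact k
  have hcontL : ContinuousAt L 0 := by
    rw [show L = _ from funext hL]
    fun_prop (disch := (simp only [zero_mul, add_zero]; positivity))
  have hcontU : ContinuousAt U 0 := by
    rw [show U = _ from funext hU]
    fun_prop (disch := (simp only [zero_mul, add_zero]; positivity))
  have hlim : L 0 ≤ U 0 :=
    le_of_tendsto_of_tendsto (hcontL.tendsto.mono_left nhdsWithin_le_nhds)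
      (hcontU.tendsto.mono_left nhdsWithin_le_nhds)
      (eventually_nhdsWithin_of_forall (s := Ioi (0 : ℝ)) fun δ hδ ↦ key δ hδ)
  have hL0 : L 0 = 2 * (N x - D) := by
    rw [hL]
    simp only [zero_mul, add_zero, mul_zero]
    have e : A⁻¹ * ((N x - D) * A) = N x - D := by field_simp
    rw [e]
  have hU0 : U 0 = 4 * C₀ * B / A + 1 + 2 * (Real.log A + B / A) -
      (m : ℝ) * Real.log (4 * Real.pi * (t - s)) - 3 * (m : ℝ) / 2 + (m : ℝ) * Real.log 2 := by
    rw [hU]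
    simp only [zero_mul, add_zero, mul_zero, zero_div, Real.negMulLog_zero, div_self hApos.ne',
      one_mul]
  rw [hL0, hU0] at hlim
  /- ─── conclusion ─── -/
  have hDle : D ≤ Real.sqrt ((m : ℝ) / 2 + Λ) := by
    rw [← hD, hr, ← Real.sqrt_mul' _ hτ.le]
    refine Real.sqrt_le_sqrt ?_
    have e : ((m : ℝ) / (2 * (t - s)) - Rmin) * (t - s) = (m : ℝ) / 2 - Rmin * (t - s) := by
      field_simp
    rw [e]
    linarith only [hRΛ]
  have p1 : B / A ≤ 3 ^ m := by rw [div_le_iff₀ hApos]; linarith only [hBA]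
  have p2 : 4 * C₀ * B / A ≤ 4 * C₀ * 3 ^ m := by
    rw [mul_div_assoc]
    exact mul_le_mul_of_nonneg_left p1 (by positivity)
  have p3 : Real.log A ≤ Real.log B := Real.log_le_log hApos hAB
  have p5 : Real.log (4 * Real.pi * (t - s)) = Real.log (4 * Real.pi) + Real.log (t - s) :=
    Real.log_mul (by positivity) hτ.ne'
  have p6 : (m : ℝ) * Real.log 2 ≤ (m : ℝ) * Real.log (4 * Real.pi) :=
    mul_le_mul_of_nonneg_left (Real.log_le_log two_pos (by linarith [Real.pi_gt_three]))
      (by positivity)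
  have hm0 : (0 : ℝ) ≤ m := by positivity
  have hlogB : N x + (m : ℝ) / 2 * Real.log (t - s) -
      (2 * 3 ^ m * C₀ + 3 ^ m + 1 / 2 + Real.sqrt ((m : ℝ) / 2 + Λ)) ≤ Real.log B := by
    rw [p5] at hlim
    linarith only [hlim, p2, p1, p3, hDle, p6, hm0]
  calc Real.exp (-(2 * 3 ^ m * C₀ + 3 ^ m + 1 / 2 + Real.sqrt ((m : ℝ) / 2 + Λ))) *
        (t - s) ^ ((m : ℝ) / 2) * Real.exp (N x)
      = Real.exp (N x + (m : ℝ) / 2 * Real.log (t - s) -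
          (2 * 3 ^ m * C₀ + 3 ^ m + 1 / 2 + Real.sqrt ((m : ℝ) / 2 + Λ))) := by
        rw [Real.rpow_def_of_pos hτ, ← Real.exp_add, ← Real.exp_add]
        ring_nf
    _ ≤ Real.exp (Real.log B) := Real.exp_le_exp.2 hlogB
    _ = B := Real.exp_log hBpos

end Literature.Geometry.Riemannian

end
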